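import Literature.NumberTheory.LFunctions.Zhang2022.KnifeEdgeLenLongLegChiWindow
import Literature.NumberTheory.LFunctions.Zhang2022.PrimitiveCharOrthogonality

/-!
# Zhang (2022), rung F-S3 (§D edge len, stmt-Parity-20446 `LongPairsGradedTables`): the BRIDGING IDENTITIES between the
# kernel lowering of the degree-2 cell (`TauTwoLowering.tauTwoLoweredSum`, p546047) and the leg-split slots' data
# (`longPsiData χ (dilHead D (upsHead χ)) g f`, `nuHead χ` of `KnifeEdgeLenLongLegChiWindow`, p564811/p567123) — finite
# Dirichlet-polynomial algebra, THEOREMS ONLY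

Y. Zhang, *Discrete mean estimates and the Landau–Siegel zero*, arXiv:2211.02515v1 [Zhang2022LandauSiegel] — an
unrefereed manuscript under adjudication. **WHAT THIS IS NOT: not a claim about Theorems 1–2 of arXiv:2211.02515, about
Landau–Siegel zeros, or about Parity. The programme SEARCHES and TYPES; no claim about Landau–Siegel zeros, Theorems 1–2
of arXiv:2211.02515 or a repaired Margin232 until a kernel theorem says so.** Nothing is asserted about any OPEN slot; no
`def`; no Assumption (A).

The kernel lowering (DISPLAY #3 §1 (1a), `KnifeEdgeLenZDegreeTauTwoLowering`) writes the degree-2 cell as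
`conj τ₂ = −τ(χ)⁻¹·𝔖 + R₁` with `𝔖 = Σ_{(ψ,ρ)} χ(p)·Re 𝔠*·[ψ(D)D^{1−ρ}G(ρ,ψ)Q_g(ρ)H_f(ρ)]·F(1−ρ,ψ̄)·Re ω`, while Lemma 8.1's
slots (`Lemma81LongPsiDil`, `FormulaILongPsiDil`, …) speak about `A(𝐚₁;s,ψ) = Lemma81.dirPoly (Nlong D) 𝐚₁ ψ s` and
`A(𝐚₂;1−s,ψ̄) = Lemma81.dirPoly (Nsupp D) 𝐚₂ ψ⁻¹ (1−s)`. This file proves that for the cell's data the two brackets are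
THE SAME Dirichlet polynomials (owed item O5 of ls-knife-crit-1's (q)-read of DISPLAY #6, 2026-08-27T20:16:55Z):

* `dirPoly_longPsiData_dilHead` / **`dirPoly_longPsiData_cell`** — ψ-side: `A(𝐚₁;s,ψ)` for
  `𝐚₁ = dilHead D b₀ ⋆ (χg̃) ⋆ (χf̃)` truncated at `Nlong D` factorises EXACTLY as
  `ψ(D)·D^{1−s}·(Σ_{a≤D⁴} b₀(a)ψ(a)a^{−s})·Q_g(s)·Q_f(s)`; for the cell's head `b₀ = upsHead χ` the middle factor is `G(s,ψ)`
  (`Skeleton.Gpoly`), `Q_u = KnifeEdge.profPoly χ x u (⌊P⌋+1)`;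
* **`dirPoly_nuHead_eq_FpolyBar`** — k-side: `Lemma81.dirPoly N (nuHead χ) ψ⁻¹ s = F(s,ψ̄)` (`Skeleton.FpolyBar`) for every
  `N > D⁴`;
* the ingredients: the finite «Dirichlet series of a convolution = product of the Dirichlet series» identity once the
  truncation exceeds the product of the supports (private), the head factor `sum_dilHead_psi_cpow`
  (`Σ_{e≤D⁵} dilHead(e)ψ(e)e^{−s} = ψ(D)D^{1−s}Σ_{a≤D⁴} b₀(a)ψ(a)a^{−s}`), the support of the profile weights
  (`profData_eq_zero_of_floor_lt`: `g(log u/log P) = 0` for `u > ⌊P⌋`), `sum_profData_psi_cpow_eq_profPoly`,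
  `sum_upsHead_psi_cpow_eq_Gpoly`.

Consequence for the cell's bookkeeping (not proved here — the weights `Re 𝔠*`, `Re ω` and the summation over `idx χ` are
the transfer's business): `𝔖`'s bracket at `(ψ,ρ)` equals `A(𝐚₁;ρ,ψ)·A(𝐚₂;1−ρ,ψ̄)` with the leg-split truncations
`(Nlong D, Nsupp D)` as soon as `D⁴ < Nsupp D`.

## References

* Y. Zhang, arXiv:2211.02515v1 (2022): §3 p. 6 (`F`, `G`), §4 Lemma 4.8 p. 9, §7 p. 13 (`A(a;s,ψ)`), §8 Lemma 8.1,
  (8.5), (8.8) p. 16. [cite: Zhang2022LandauSiegel, §7 p. 13; §8 Lemma 8.1]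
-/

noncomputable section

open Complex Real ComplexConjugate Finset

namespace Literature.NumberTheory.LFunctions.Zhang2022.KnifeEdge.LongLegSplit

open Repair Skeleton

/-- The truncated Dirichlet-convolution sum equals the product of the factor sums once the truncation
exceeds the product of the supports (finite «Dirichlet series of a convolution = product»). [folklore] -/
private theorem sum_range_sum_divisorsAntidiagonal_mul_eq (A C : ℕ → ℂ) {E M N : ℕ}
    (hA : ∀ e, E < e → A e = 0) (hC : ∀ m, M < m → C m = 0) (hN : E * M < N) :
    ∑ n ∈ Finset.range N, ∑ p ∈ n.divisorsAntidiagonal, A p.1 * C p.2 =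
      (∑ e ∈ Icc 1 E, A e) * (∑ m ∈ Icc 1 M, C m) := by
  classical
  rw [Finset.sum_mul_sum, ← Finset.sum_product', Finset.sum_sigma']
  refine Finset.sum_bij_ne_zero (fun q _ _ => (q.2.1, q.2.2)) ?_ ?_ ?_ ?_
  · -- maps into Icc × Icc
    rintro ⟨n, ⟨e, m⟩⟩ hq hne
    simp only [Finset.mem_sigma, Finset.mem_range, Nat.mem_divisorsAntidiagonal] at hq
    obtain ⟨hn, hem, hn0⟩ := hq
    have he0 : e ≠ 0 := by rintro rfl; simp at hem; exact hn0 hem.symm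
    have hm0 : m ≠ 0 := by rintro rfl; simp at hem; exact hn0 hem.symm
    have heE : e ≤ E := not_lt.mp fun h => hne (by simp [hA e h])
    have hmM : m ≤ M := not_lt.mp fun h => hne (by simp [hC m h])
    simp only [Finset.mem_product, Finset.mem_Icc]
    exact ⟨⟨Nat.one_le_iff_ne_zero.mpr he0, heE⟩, ⟨Nat.one_le_iff_ne_zero.mpr hm0, hmM⟩⟩
  · -- injective
    rintro ⟨n, ⟨e, m⟩⟩ hq _ ⟨n', ⟨e', m'⟩⟩ hq' _ h
    simp only [Prod.mk.injEq] at h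
    obtain ⟨rfl, rfl⟩ := h
    simp only [Finset.mem_sigma, Finset.mem_range, Nat.mem_divisorsAntidiagonal] at hq hq'
    obtain ⟨_, hem, _⟩ := hq
    obtain ⟨_, hem', _⟩ := hq'
    subst hem; subst hem'
    rfl
  · -- surjective onto nonzero terms
    rintro ⟨e, m⟩ hq hne
    simp only [Finset.mem_product, Finset.mem_Icc] at hq
    obtain ⟨⟨he1, heE⟩, ⟨hm1, hmM⟩⟩ := hq
    refine ⟨⟨e * m, (e, m)⟩, ?_, by simpa using hne, rfl⟩
    rw [Finset.mem_sigma, Finset.mem_range, Nat.mem_divisorsAntidiagonal]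
    exact ⟨lt_of_le_of_lt (Nat.mul_le_mul heE hmM) hN, rfl, Nat.mul_ne_zero (by omega) (by omega)⟩
  · rintro ⟨n, ⟨e, m⟩⟩ _ _
    rfl


/-- Multiplicativity of the Dirichlet-polynomial weight `n ↦ ψ(n)·n^{−s}` on a divisor pair. [folklore] -/
private theorem psi_cpow_mul {k : ℕ} (ψ : DirichletCharacter ℂ k) (s : ℂ) {n : ℕ} {p : ℕ × ℕ}
    (hp : p ∈ n.divisorsAntidiagonal) :
    ψ (n : ZMod k) * (n : ℂ) ^ (-s) =
      (ψ (p.1 : ZMod k) * (p.1 : ℂ) ^ (-s)) * (ψ (p.2 : ZMod k) * (p.2 : ℂ) ^ (-s)) := by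
  have hn : p.1 * p.2 = n := (Nat.mem_divisorsAntidiagonal.mp hp).1
  rw [← hn, Nat.cast_mul, map_mul, Nat.cast_mul, Complex.natCast_mul_natCast_cpow]
  ring

/-- The summand of `dirPoly` for a Dirichlet convolution splits over the divisor pairs. [folklore] -/
private theorem conv_mul_psi_cpow_eq {k : ℕ} (ψ : DirichletCharacter ℂ k) (s : ℂ) (b L : ℕ → ℂ) (n : ℕ) :
    (∑ p ∈ n.divisorsAntidiagonal, b p.1 * L p.2) * ψ (n : ZMod k) * (n : ℂ) ^ (-s) =
      ∑ p ∈ n.divisorsAntidiagonal,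
        (b p.1 * ψ (p.1 : ZMod k) * (p.1 : ℂ) ^ (-s)) * (L p.2 * ψ (p.2 : ZMod k) * (p.2 : ℂ) ^ (-s)) := by
  rw [Finset.sum_mul, Finset.sum_mul]
  refine Finset.sum_congr rfl fun p hp => ?_
  rw [mul_assoc (b p.1 * L p.2), psi_cpow_mul ψ s hp]
  ring

/-- The in-class profile weight `χ(u)g(log u/log P)` vanishes past `⌊P⌋` (`g ≡ 0` on `[1,∞)`, `D ≥ 2`).
[cite: Zhang2022LandauSiegel, §7 (7.2) p. 13; §8 (8.8)] -/
theorem profData_eq_zero_of_floor_lt {D : ℕ} (hD : 2 ≤ D) (χ : DirichletCharacter ℂ D) {g g' : ℝ → ℂ}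
    (hg : InClassPiece g g') {u : ℕ} (hu : ⌊bigP D⌋₊ < u) : profData χ g u = 0 := by
  have hP : 0 < Real.log (bigP D) := by
    rw [bigP, Real.log_exp]; exact pow_pos (Real.log_pos (by exact_mod_cast hD)) 9
  have hPu : bigP D < u := Nat.lt_of_floor_lt hu
  have hP0 : 0 < bigP D := Real.exp_pos _
  have h1 : 1 ≤ Real.log u / Real.log (bigP D) := by
    rw [le_div_iff₀ hP, one_mul]
    exact Real.log_le_log hP0 hPu.le
  rw [profData, hg.vanish _ h1, mul_zero]

/-- **The head factor:** `Σ_{e ≤ D⁵} dilHead(e)ψ(e)e^{−s} = ψ(D)·D^{1−s}·Σ_{a ≤ D⁴} b₀(a)ψ(a)a^{−s}` for a head `b₀`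
supported `≤ D⁴` — the amplitude-`D` dilation read on the Dirichlet-polynomial side (the factor `ψ(D)D^{1−s}` of the
lowering). [cite: Zhang2022LandauSiegel, §4 Lemma 4.8 p. 9; §7 p. 13 (`A(a;s,ψ)`)] -/
theorem sum_dilHead_psi_cpow {D : ℕ} (hD : 0 < D) {k : ℕ} (ψ : DirichletCharacter ℂ k) (s : ℂ)
    (b₀ : ℕ → ℂ) (hb₀ : ∀ n : ℕ, D ^ 4 < n → b₀ n = 0) :
    ∑ e ∈ Icc 1 (D ^ 5), dilHead D b₀ e * ψ (e : ZMod k) * (e : ℂ) ^ (-s) =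
      ψ (D : ZMod k) * (D : ℂ) ^ (1 - s) *
        ∑ a ∈ Icc 1 (D ^ 4), b₀ a * ψ (a : ZMod k) * (a : ℂ) ^ (-s) := by
  classical
  have hD0 : (D : ℂ) ≠ 0 := by exact_mod_cast hD.ne'
  -- restrict the `e`-sum to the image of `a ↦ D·a`
  have himg : (Icc 1 (D ^ 4)).image (fun a => D * a) ⊆ Icc 1 (D ^ 5) := by
    intro e he
    obtain ⟨a, ha, rfl⟩ := Finset.mem_image.mp he
    rw [Finset.mem_Icc] at ha ⊢
    refine ⟨Nat.mul_pos hD (by omega), ?_⟩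
    calc D * a ≤ D * D ^ 4 := Nat.mul_le_mul_left _ ha.2
      _ = D ^ 5 := by ring
  have hzero : ∀ e ∈ Icc 1 (D ^ 5), e ∉ (Icc 1 (D ^ 4)).image (fun a => D * a) →
      dilHead D b₀ e * ψ (e : ZMod k) * (e : ℂ) ^ (-s) = 0 := by
    intro e he hne
    by_cases hdvd : D ∣ e
    · obtain ⟨a, rfl⟩ := hdvd
      have ha : ¬ (1 ≤ a ∧ a ≤ D ^ 4) := by
        intro h
        exact hne (Finset.mem_image.mpr ⟨a, Finset.mem_Icc.mpr h, rfl⟩)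
      rw [dilHead_mul hD]
      rcases Nat.eq_zero_or_pos a with rfl | hapos
      · rw [Finset.mem_Icc] at he; omega
      · have : D ^ 4 < a := by omega
        rw [hb₀ a this]; simp
    · rw [dilHead_eq_zero_of_not_dvd b₀ hdvd]; simp
  rw [← Finset.sum_subset himg hzero,
    Finset.sum_image fun a _ a' _ h => Nat.eq_of_mul_eq_mul_left hD h, Finset.mul_sum]
  refine Finset.sum_congr rfl fun a _ => ?_
  rw [dilHead_mul hD, Nat.cast_mul, map_mul, Nat.cast_mul, Complex.natCast_mul_natCast_cpow,
    show (1 : ℂ) - s = 1 + (-s) by ring, Complex.cpow_add _ _ hD0, Complex.cpow_one]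
  ring

/-- The pair factor `Σ_{uv=m} profData g u · profData f v` vanishes past `⌊P⌋²`. [folklore] -/
private theorem pairData_eq_zero_of_lt {D : ℕ} (hD : 2 ≤ D) (χ : DirichletCharacter ℂ D) {g g' f f' : ℝ → ℂ}
    (hg : InClassPiece g g') (hf : InClassPiece f f') {m : ℕ} (hm : ⌊bigP D⌋₊ ^ 2 < m) :
    ∑ q ∈ m.divisorsAntidiagonal, profData χ g q.1 * profData χ f q.2 = 0 := by
  refine Finset.sum_eq_zero fun q hq => ?_
  have hm' : q.1 * q.2 = m := (Nat.mem_divisorsAntidiagonal.mp hq).1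
  by_cases hu : ⌊bigP D⌋₊ < q.1
  · rw [profData_eq_zero_of_floor_lt hD χ hg hu, zero_mul]
  · have hv : ⌊bigP D⌋₊ < q.2 := by
      by_contra hv
      push Not at hu hv
      have : q.1 * q.2 ≤ ⌊bigP D⌋₊ * ⌊bigP D⌋₊ := Nat.mul_le_mul hu hv
      rw [hm', ← pow_two] at this
      omega
    rw [profData_eq_zero_of_floor_lt hD χ hf hv, mul_zero]

/-- The single-profile factor IS the tree's profile polynomial `Q_g = KnifeEdge.profPoly χ x g (⌊P⌋+1)`.
[cite: Zhang2022LandauSiegel, §2 (2.23)–(2.25); §7 p. 13 (`A(a;s,ψ)`)] -/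
theorem sum_profData_psi_cpow_eq_profPoly {D : ℕ} (χ : DirichletCharacter ℂ D) (x : Chr D) (g : ℝ → ℂ) (s : ℂ) :
    ∑ u ∈ Icc 1 ⌊bigP D⌋₊, profData χ g u * x.ψ (u : ZMod x.p) * (u : ℂ) ^ (-s) =
      profPoly χ x g (⌊bigP D⌋₊ + 1) s := by
  rw [profPoly, ← Finset.Ico_add_one_right_eq_Icc]
  refine Finset.sum_congr rfl fun u _ => ?_
  rw [profData, pc]
  ring

/-- **THE BRIDGING IDENTITY, general dilated head** (`D ≥ 2`, `b₀` supported `≤ D⁴`, `g, f` in-class pieces): the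
Dirichlet polynomial `A(𝐚₁;s,ψ)` of `𝐚₁ = dilHead D b₀ ⋆ (χg̃) ⋆ (χf̃)` truncated at `Nlong D = D⁵(⌊P⌋+1)²` (≥ the support)
FACTORISES EXACTLY: `= ψ(D)·D^{1−s}·(Σ_{a≤D⁴} b₀(a)ψ(a)a^{−s})·Q_g(s)·Q_f(s)`. Finite algebra: Dirichlet series of a
convolution = product, twice; the truncations never bite. [cite: Zhang2022LandauSiegel, §7 p. 13 (`A(a;s,ψ)`); §8 Lemma 8.1, (8.8) p. 16] -/
theorem dirPoly_longPsiData_dilHead {D : ℕ} (hD : 2 ≤ D) (χ : DirichletCharacter ℂ D) (x : Chr D)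
    (b₀ : ℕ → ℂ) (hb₀ : ∀ n : ℕ, D ^ 4 < n → b₀ n = 0) {g g' f f' : ℝ → ℂ}
    (hg : InClassPiece g g') (hf : InClassPiece f f') (s : ℂ) :
    Lemma81.dirPoly (Nlong D) (longPsiData χ (dilHead D b₀) g f) x.ψ s =
      x.ψ (D : ZMod x.p) * (D : ℂ) ^ (1 - s) *
        (∑ a ∈ Icc 1 (D ^ 4), b₀ a * x.ψ (a : ZMod x.p) * (a : ℂ) ^ (-s)) *
        (profPoly χ x g (⌊bigP D⌋₊ + 1) s * profPoly χ x f (⌊bigP D⌋₊ + 1) s) := by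
  have hD0 : 0 < D := by omega
  set M := ⌊bigP D⌋₊ with hM
  -- the pair factor with its own weight
  set L : ℕ → ℂ := fun m => ∑ q ∈ m.divisorsAntidiagonal, profData χ g q.1 * profData χ f q.2 with hL
  -- Step A for the outer convolution
  have hA : ∀ n : ℕ, longPsiData χ (dilHead D b₀) g f n * x.ψ (n : ZMod x.p) * (n : ℂ) ^ (-s) =
      ∑ p ∈ n.divisorsAntidiagonal,
        (dilHead D b₀ p.1 * x.ψ (p.1 : ZMod x.p) * (p.1 : ℂ) ^ (-s)) *
          (L p.2 * x.ψ (p.2 : ZMod x.p) * (p.2 : ℂ) ^ (-s)) := fun n =>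
    conv_mul_psi_cpow_eq x.ψ s (dilHead D b₀) L n
  -- Step B: the outer DOUBLE
  have hN : D ^ 5 * M ^ 2 < Nlong D := by
    rw [Nlong]
    have : M ^ 2 < (M + 1) ^ 2 := by nlinarith
    exact Nat.mul_lt_mul_of_pos_left this (by positivity)
  have hAv : ∀ e, D ^ 5 < e → dilHead D b₀ e * x.ψ (e : ZMod x.p) * (e : ℂ) ^ (-s) = 0 := by
    intro e he
    rw [dilHead_eq_zero_of_pow_five_lt b₀ hb₀ he]; simp
  have hCv : ∀ m, M ^ 2 < m → L m * x.ψ (m : ZMod x.p) * (m : ℂ) ^ (-s) = 0 := by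
    intro m hm
    rw [hL]; dsimp only
    rw [pairData_eq_zero_of_lt hD χ hg hf hm]; simp
  rw [Lemma81.dirPoly]
  simp_rw [hA]
  rw [sum_range_sum_divisorsAntidiagonal_mul_eq _ _ hAv hCv hN, sum_dilHead_psi_cpow hD0 x.ψ s b₀ hb₀]
  -- Step C: the inner DOUBLE for the pair factor
  have hinner : ∑ m ∈ Icc 1 (M ^ 2), L m * x.ψ (m : ZMod x.p) * (m : ℂ) ^ (-s) =
      profPoly χ x g (M + 1) s * profPoly χ x f (M + 1) s := by
    have h0 : L 0 * x.ψ ((0 : ℕ) : ZMod x.p) * ((0 : ℕ) : ℂ) ^ (-s) = 0 := by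
      rw [hL]; simp
    have hrange : ∑ m ∈ Icc 1 (M ^ 2), L m * x.ψ (m : ZMod x.p) * (m : ℂ) ^ (-s) =
        ∑ m ∈ Finset.range (M ^ 2 + 1), L m * x.ψ (m : ZMod x.p) * (m : ℂ) ^ (-s) := by
      rw [Finset.range_eq_Ico, Finset.sum_eq_sum_Ico_succ_bot (Nat.succ_pos _), h0, zero_add]
      simp only [Nat.succ_eq_add_one, zero_add, Finset.Ico_add_one_right_eq_Icc]
    rw [hrange]
    have hA' : ∀ m : ℕ, L m * x.ψ (m : ZMod x.p) * (m : ℂ) ^ (-s) =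
        ∑ q ∈ m.divisorsAntidiagonal,
          (profData χ g q.1 * x.ψ (q.1 : ZMod x.p) * (q.1 : ℂ) ^ (-s)) *
            (profData χ f q.2 * x.ψ (q.2 : ZMod x.p) * (q.2 : ℂ) ^ (-s)) := fun m => by
      rw [hL]; exact conv_mul_psi_cpow_eq x.ψ s (profData χ g) (profData χ f) m
    simp_rw [hA']
    have hgv : ∀ u, M < u → profData χ g u * x.ψ (u : ZMod x.p) * (u : ℂ) ^ (-s) = 0 := by
      intro u hu; rw [profData_eq_zero_of_floor_lt hD χ hg hu]; simp
    have hfv : ∀ v, M < v → profData χ f v * x.ψ (v : ZMod x.p) * (v : ℂ) ^ (-s) = 0 := by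
      intro v hv; rw [profData_eq_zero_of_floor_lt hD χ hf hv]; simp
    rw [sum_range_sum_divisorsAntidiagonal_mul_eq _ _ hgv hfv (by rw [pow_two]; omega),
      sum_profData_psi_cpow_eq_profPoly, sum_profData_psi_cpow_eq_profPoly]
  rw [hinner]

/-- On `a ≤ D⁴` the cell's head is `υ`: `Σ_{a≤D⁴} upsHead(a)ψ(a)a^{−s} = G(s,ψ)` (`Skeleton.Gpoly`).
[cite: Zhang2022LandauSiegel, §3 p. 6 (`G(s,ψ)`); §4 Lemma 4.8 p. 9] -/
theorem sum_upsHead_psi_cpow_eq_Gpoly {D : ℕ} (χ : DirichletCharacter ℂ D) (x : Chr D) (s : ℂ) :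
    ∑ a ∈ Icc 1 (D ^ 4), upsHead χ a * x.ψ (a : ZMod x.p) * (a : ℂ) ^ (-s) = Gpoly χ x s := by
  rw [Gpoly]
  refine Finset.sum_congr rfl fun a ha => ?_
  rw [upsHead_apply, if_pos (Finset.mem_Icc.mp ha).2]

/-- **THE BRIDGING IDENTITY FOR THE `𝒳₂` CELL** (owed item O5 of ls-knife-crit-1's (q)-read of DISPLAY #6,
2026-08-27T20:16:55Z; blocker B5): for `D ≥ 2` and in-class pieces `g, f`, the Dirichlet polynomial of the cell datum
`𝐚₁ = longPsiData χ (dilHead D (upsHead χ)) g f` (the ψ-side datum of the slots `FormulaILongPsiDil`/`Lemma81LongPsiDil`)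
truncated at `Nlong D` IS the bracket `ψ(D)·D^{1−s}·G(s,ψ)·Q_g(s)·H_f(s)` of the kernel lowering
`TauTwoLowering.tauTwoLoweredSum` (p546047): `Lemma81.dirPoly (Nlong D) 𝐚₁ ψ s = ψ(D)·D^{1−s}·Gpoly·profPoly g·profPoly f`.
[cite: Zhang2022LandauSiegel, §4 Lemma 4.8 p. 9; §7 p. 13 (`A(a;s,ψ)`); §8 Lemma 8.1, (8.5), (8.8) p. 16] -/
theorem dirPoly_longPsiData_cell {D : ℕ} (hD : 2 ≤ D) (χ : DirichletCharacter ℂ D) (x : Chr D)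
    {g g' f f' : ℝ → ℂ} (hg : InClassPiece g g') (hf : InClassPiece f f') (s : ℂ) :
    Lemma81.dirPoly (Nlong D) (longPsiData χ (dilHead D (upsHead χ)) g f) x.ψ s =
      x.ψ (D : ZMod x.p) * (D : ℂ) ^ (1 - s) * Gpoly χ x s *
        (profPoly χ x g (⌊bigP D⌋₊ + 1) s * profPoly χ x f (⌊bigP D⌋₊ + 1) s) := by
  rw [dirPoly_longPsiData_dilHead hD χ x (upsHead χ) (fun _ hn => upsHead_eq_zero χ hn) hg hf s,
    sum_upsHead_psi_cpow_eq_Gpoly]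

/-- **THE k-SIDE BRIDGE:** for ANY truncation `N > D⁴` (e.g. `Nsupp D` eventually), the Dirichlet polynomial of the
cell's k-datum `nuHead χ = ν·1_{≤D⁴}` against `ψ̄ = ψ⁻¹` IS the tree's `F(s,ψ̄)` (`Skeleton.FpolyBar`):
`Lemma81.dirPoly N (nuHead χ) ψ⁻¹ s = FpolyBar χ x s` (`ψ⁻¹(n) = conj ψ(n)`, `PrimChar.inv_apply_eq_conj`; the `n = 0`
term dies on `ψ⁻¹(0) = 0`). [cite: Zhang2022LandauSiegel, §3 p. 6 (`F(s,ψ)`); §4 Lemma 4.4, Lemma 4.8 p. 9; §7 p. 13] -/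
theorem dirPoly_nuHead_eq_FpolyBar {D : ℕ} [NeZero D] (χ : DirichletCharacter ℂ D) (x : Chr D) {N : ℕ}
    (hN : D ^ 4 < N) (s : ℂ) :
    Lemma81.dirPoly N (nuHead χ) x.ψ⁻¹ s = FpolyBar χ x s := by
  classical
  rw [Lemma81.dirPoly, FpolyBar]
  have hsub : Icc 1 (D ^ 4) ⊆ Finset.range N := by
    intro n hn
    rw [Finset.mem_Icc] at hn
    rw [Finset.mem_range]; omega
  rw [← Finset.sum_subset hsub]
  · refine Finset.sum_congr rfl fun n hn => ?_
    rw [nuHead_apply, if_pos (Finset.mem_Icc.mp hn).2, PrimChar.inv_apply_eq_conj]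
  · intro n hn hnot
    rw [Finset.mem_range] at hn
    rw [Finset.mem_Icc, not_and_or, not_le, not_le] at hnot
    rcases hnot with h0 | hbig
    · have : n = 0 := by omega
      subst this
      have h0 : (x.ψ)⁻¹ ((0 : ℕ) : ZMod x.p) = 0 := by
        rw [Nat.cast_zero]
        exact MulChar.map_nonunit _ (by rw [isUnit_zero_iff]; exact zero_ne_one)
      rw [h0]; simp
    · rw [nuHead_eq_zero χ hbig]; simp
end Literature.NumberTheory.LFunctions.Zhang2022.KnifeEdge.LongLegSplit

end
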